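import Summits.CriticalPhenomena.PercolationContinuityZ3.Theorems.Transplant.Slab111K3Continuity
import Summits.CriticalPhenomena.PercolationContinuityZ3.Theorems.Transplant.Slab111SKFinalK4
import Summits.CriticalPhenomena.PercolationContinuityZ3.Theorems.Transplant.Slab111SKFinalK5
import Summits.CriticalPhenomena.PercolationContinuityZ3.Theorems.Transplant.Slab111SKFinalK6
import Summits.CriticalPhenomena.PercolationContinuityZ3.Theorems.Transplant.Slab111SKFinalK7
import Summits.CriticalPhenomena.PercolationContinuityZ3.Theorems.Transplant.Slab111SKFinalK8
import Summits.CriticalPhenomena.PercolationContinuityZ3.Theorems.Transplant.Slab111SKFinalK9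
import Summits.CriticalPhenomena.PercolationContinuityZ3.Theorems.Transplant.Slab111HubXFinal
import Summits.CriticalPhenomena.PercolationContinuityZ3.Theorems.Transplant.Slab111Honeycomb
import Summits.CriticalPhenomena.PercolationContinuityZ3.Theorems.Transplant.DiamondFilmTwoSubdiv
import HarnessLib

/-!
# TARGET 2x (oblique films) WITHOUT p205010 — the residue: the dice lattice and the diamond films of thickness `≥ 3`

builds on p205010 (kernel theorem, internal audit signed; external expert review pending) — NOT used: p205010's declarations are absent from the DECLARATION-LEVEL cones
of the theorems below (the import graph is not separated; by name the whole target is closed through p205010 in «DiamondFilmOwnCriticalContinuityHolds».`obliqueFilmOwnCriticalContinuity_holds`).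
Lane `prim-bschramm`, seat `prim-bschramm-p2` (gen 39; class C1b; memo `HOME/bschramm/P2-LATTICES.md` §139–§140); helper file (`--supports stmt-CriticalPhenomena-4575 --as helper`).
`ObliqueFilmOwnCriticalContinuity` («StatementObliqueFilms») = (every `(111)`-film of `ℤ³`, `k ≥ 1`) ∧ (every `(001)`-film of the diamond lattice, `k ≥ 2`).  Independently
of p205010 the tree proves the `(111)`-films for every `k ≠ 2` (`k = 1` «Slab111Honeycomb», `k = 3` «Slab111K3Continuity», `4 ≤ k ≤ 9` «Slab111SKFinalK4…K9», `k ≥ 10`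
«Slab111HubXFinal») and the diamond film `k = 2` («DiamondFilmTwoSubdiv»); so the target is EQUIVALENT, without p205010, to its residue: the dice lattice `F_2` and the
diamond films of thickness `k ≥ 3` — **`obliqueFilmOwnCriticalContinuity_iff_residue`**.  (This file dispatches the `(111)`-row from the per-thickness finals directly;
«Slab111RowNeTwo»/«ObliqueFilmsResidual» state the same through the row lemma `slab111OwnCriticalContinuity_ne_two`.)
[cite: BenjaminiSchramm1996, Conj. 4 / Question 3] [cite: DuminilCopinSidoraviciusTassion2016, Thm. 1 + p. 3 "Two generalizations"]
-/

noncomputable section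

namespace Summit.CriticalPhenomena.PercolationContinuityZ3.Theorems.Transplant

open Literature.Probability.Percolation Literature.Probability.LatticeModels SimpleGraph

/-- **TARGET 2x WITHOUT p205010 IS EQUIVALENT TO ITS RESIDUE**: the `(111)`-film of thickness `2` (the dice lattice) and the diamond `(001)`-films of thickness `≥ 3`
(the `(111)`-films `k ≠ 2` are dispatched over the per-thickness certifications, the diamond film `k = 2` is the subdivided square lattice).
[cite: BenjaminiSchramm1996, Conj. 4 / Question 3] [cite: DuminilCopinSidoraviciusTassion2016, Thm. 1] -/
theorem obliqueFilmOwnCriticalContinuity_iff_residue :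
    ObliqueFilmOwnCriticalContinuity ↔ Slab111OwnCriticalContinuity 2 ∧ ∀ k : ℕ, 3 ≤ k → DiamondFilmOwnCriticalContinuity k := by
  unfold ObliqueFilmOwnCriticalContinuity
  refine and_congr ⟨fun h => h 2 (by norm_num), fun h2 k hk => ?_⟩ ⟨fun h k hk => h k (by omega), fun h k hk => ?_⟩
  · rcases Nat.lt_or_ge k 10 with h10 | h10
    · interval_cases k
      · exact slab111OwnCriticalContinuity_one
      · exact h2
      · exact slab111OwnCriticalContinuity_k3
      · exact slab111OwnCriticalContinuity_of_shapedLinkage (by norm_num) Slab111.shapedLinkage_three_k4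
      · exact slab111OwnCriticalContinuity_of_shapedLinkage (by norm_num) Slab111.shapedLinkage_three_k5
      · exact slab111OwnCriticalContinuity_of_shapedLinkage (by norm_num) Slab111.shapedLinkage_three_k6
      · exact slab111OwnCriticalContinuity_of_shapedLinkage (by norm_num) Slab111.shapedLinkage_three_k7
      · exact slab111OwnCriticalContinuity_of_shapedLinkage (by norm_num) Slab111.shapedLinkage_three_k8
      · exact slab111OwnCriticalContinuity_of_shapedLinkage (by norm_num) Slab111.shapedLinkage_three_k9
    · exact slab111OwnCriticalContinuity_of_hubX h10
  · rcases Nat.lt_or_ge k 3 with h3 | h3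
    · obtain rfl : k = 2 := by omega
      exact diamondFilmOwnCriticalContinuity_two
    · exact h k h3

end Summit.CriticalPhenomena.PercolationContinuityZ3.Theorems.Transplant

end
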